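import Summits.ResolutionOfSingularities.ResolutionOfSingularities.Theorems.FrobeniusLadderFInjectiveMacaulayficationFilteredConeFiModelRel
import Summits.ResolutionOfSingularities.ResolutionOfSingularities.Theorems.FrobeniusLadderFInjectiveMacaulayficationE8LineDeformedData
import HarnessLib

/-!
# `E₈⁰ × 𝔸¹` DEFORMED ALONG ITS BAD LINE — the first NON-CONICAL non-isolated crux instance, at EVERY prime `p`
# (crux `FrobeniusLadder.FInjectiveMacaulayfication` stmt-ResolutionOfSingularities-15315, chain w45a; calibration of the relative
# filtered engine `FilteredConeFiModelRel` (lead); lead seat res-L1-w45a-lead-1 gen 3)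

[OURS · L1 W4.5a] AI-written; AI review is weaker than expert review. NOT a statement of any manuscript; no named fact.

`f = X₃² + X₁³ + X₂⁵ + X₀·X₁²X₂²`, `R = k[X₀,…,X₃]/(f)`: singular (and at `p = 2,3,5` non-F-injective) exactly along the line
`V(X₁,X₂,X₃)`, with the `E₈⁰` cone as `(0,10,6,15)`-weighted tangent cone along the line and a genuinely non-homogeneous
deformation term of higher weight. THEOREMS: for EVERY prime `p` and every field of characteristic `p`, the weighted blow-up of
`Spec R` along the line is a proper birational model with domain stalks satisfying the crux clause at every point
(`e8LineDeformedFiModel`), and at the generic point `η` of the line the `∃`-clause of the registered hole-#3 stub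
`stub_confinedIsoStepStrongPlus` holds (`e8LineDeformed_strongPlusStep`; `exists_eta`). One application of
`FilteredConeFiModelRel` with `J = {1,2,3}`; data from `E8LineDeformedData` (lead) and the cone's off-line regularity from
`E8LineGradedFiModel` (lead p500918). No definitions, no named facts. [folklore]
-/

set_option linter.dupNamespace false

noncomputable section

open Literature.AlgebraicGeometry.Resolution AlgebraicGeometry MvPolynomial CategoryTheory

namespace Summit.ResolutionOfSingularities.ResolutionOfSingularities.Theorems.FInjectiveMacaulayfication.E8LineDeformedFiModel

open Summit.ResolutionOfSingularities.ResolutionOfSingularities.Theorems.FInjectiveMacaulayfication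

/-- The weight bookkeeping on `J = {1,2,3}`. [folklore] -/
theorem weights_on_J : ∀ v ∈ ({1, 2, 3} : Finset (Fin 4)), 0 < (![0, 10, 6, 15] : Fin 4 → ℕ) v ∧
    (![0, 3, 5, 2] : Fin 4 → ℕ) v * (![0, 10, 6, 15] : Fin 4 → ℕ) v = 30 := by
  intro v hv
  simp only [Finset.mem_insert, Finset.mem_singleton] at hv
  rcases hv with rfl | rfl | rfl <;> decide

/-- The weights vanish off `J`. [folklore] -/
theorem weights_off_J : ∀ v : Fin 4, v ∉ ({1, 2, 3} : Finset (Fin 4)) → (![0, 10, 6, 15] : Fin 4 → ℕ) v = 0 := by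
  intro v hv
  fin_cases v
  · rfl
  all_goals exact absurd (by decide) hv

/-- **`E₈⁰ × 𝔸¹` DEFORMED ALONG THE LINE HAS AN F-INJECTIVE MACAULAYFICATION BY ONE WEIGHTED BLOW-UP ALONG THE LINE, at every
prime `p`** (relative filtered engine). [folklore] -/
theorem e8LineDeformedFiModel : ∀ (p : ℕ) [Fact p.Prime] (k : Type) [Field k] [CharP k p]
    (f : MvPolynomial (Fin 4) k), f = MvPolynomial.X 3 ^ 2 + MvPolynomial.X 1 ^ 3 + MvPolynomial.X 2 ^ 5 +
      MvPolynomial.X 0 * MvPolynomial.X 1 ^ 2 * MvPolynomial.X 2 ^ 2 →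
    ∃ (X' : Scheme.{0}) (π : X' ⟶ Spec (.of (MvPolynomial (Fin 4) k ⧸ Ideal.span {f}))), IsProper π ∧
      Literature.AlgebraicGeometry.Resolution.IsBirational π ∧
      ∀ y : X', IsDomain (X'.presheaf.stalk y) ∧ ∀ d : ℕ, ringKrullDim (X'.presheaf.stalk y) = d →
        ∀ s : Fin d → X'.presheaf.stalk y, (Ideal.span (Set.range s)).radical.IsMaximal →
          RingTheory.Sequence.IsWeaklyRegular (X'.presheaf.stalk y) (List.ofFn s) ∧
          ∀ z : X'.presheaf.stalk y, (∃ e : ℕ, z ^ p ^ e ∈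
              Ideal.span ((fun w : X'.presheaf.stalk y => w ^ p ^ e) ''
                (Ideal.span (Set.range s) : Set (X'.presheaf.stalk y)))) →
            z ∈ Ideal.span (Set.range s) := by
  intro p _ k _ _ f hf
  obtain ⟨h30, hlow⟩ := E8LineDeformedData.initialForm k f hf
  exact FilteredConeFiModelRel.filteredConeFiModelRel p k 4 ({1, 2, 3} : Finset (Fin 4)) ⟨1, by decide⟩
    (![0, 10, 6, 15] : Fin 4 → ℕ) 30 30 (![0, 3, 5, 2] : Fin 4 → ℕ) (by norm_num) weights_on_J weights_off_J
    (E8LineGradedFiModel.veroneseSplitting k) f (MvPolynomial.X 3 ^ 2 + MvPolynomial.X 1 ^ 3 + MvPolynomial.X 2 ^ 5) h30.symm hlow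
    (E8LineDeformedData.initialForm_ne_zero k) (E8LineDeformedData.isPrime_span_f k f hf).1 (E8LineDeformedData.X_ne_zero k f hf)
    (E8LineGradedFiModel.offStratum_clause_of_regular p k _ f (fun P _ hP => E8LineDeformedData.regular_off_line k f hf P hP))
    (E8LineGradedFiModel.offStratum_clause_of_regular p k _ _
      (fun P _ hP => E8LineGradedFiModel.regular_off_line k _ rfl P hP))

/-- The generic point `η` of the bad line exists as a point of `Spec R`. [folklore] -/
theorem exists_eta (k : Type) [Field k] (f : MvPolynomial (Fin 4) k)
    (hf : f = MvPolynomial.X 3 ^ 2 + MvPolynomial.X 1 ^ 3 + MvPolynomial.X 2 ^ 5 +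
      MvPolynomial.X 0 * MvPolynomial.X 1 ^ 2 * MvPolynomial.X 2 ^ 2) :
    ∃ η : ↥(Spec (.of (MvPolynomial (Fin 4) k ⧸ Ideal.span {f}))),
      η.asIdeal = Ideal.span ((fun j : Fin 4 => Ideal.Quotient.mk (Ideal.span {f}) (MvPolynomial.X j)) ''
        ((({1, 2, 3} : Finset (Fin 4)) : Set (Fin 4)))) :=
  ⟨⟨_, E8LineDeformedData.isPrime_span_line k f hf⟩, rfl⟩

/-- **THE STRONG⁺ STEP at the generic point of the bad line of the deformed `E₈⁰ × 𝔸¹`, at every prime `p`**: the `∃`-clause of the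
registered hole-#3 stub `stub_confinedIsoStepStrongPlus` for `X₁ = Spec R`, `η` the generic point of `V(X₁,X₂,X₃)`. [folklore] -/
theorem e8LineDeformed_strongPlusStep : ∀ (p : ℕ) [Fact p.Prime] (k : Type) [Field k] [CharP k p]
    (f : MvPolynomial (Fin 4) k), f = MvPolynomial.X 3 ^ 2 + MvPolynomial.X 1 ^ 3 + MvPolynomial.X 2 ^ 5 +
      MvPolynomial.X 0 * MvPolynomial.X 1 ^ 2 * MvPolynomial.X 2 ^ 2 →
    ∀ (η : ↥(Spec (.of (MvPolynomial (Fin 4) k ⧸ Ideal.span {f})))),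
      η.asIdeal = Ideal.span ((fun j : Fin 4 => Ideal.Quotient.mk (Ideal.span {f}) (MvPolynomial.X j)) ''
        ((({1, 2, 3} : Finset (Fin 4)) : Set (Fin 4)))) →
    ∃ (X₂ : Scheme.{0}) (π : X₂ ⟶ Spec (.of (MvPolynomial (Fin 4) k ⧸ Ideal.span {f}))), IsProper π ∧
      Literature.AlgebraicGeometry.Resolution.IsBirational π ∧
      IsIntegral X₂ ∧ (∀ x : X₂, (∀ d : ℕ, ringKrullDim (X₂.presheaf.stalk x) = d → ∀ s : Fin d → X₂.presheaf.stalk x, (Ideal.span (Set.range s)).radical.IsMaximal → RingTheory.Sequence.IsWeaklyRegular (X₂.presheaf.stalk x) (List.ofFn s))) ∧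
      IsIso (π ∣_ ⟨(closure ({η} : Set ↥(Spec (.of (MvPolynomial (Fin 4) k ⧸ Ideal.span {f})))))ᶜ, isClosed_closure.isOpen_compl⟩) ∧
      ∀ x : X₂, π.base x ∈ closure ({η} : Set ↥(Spec (.of (MvPolynomial (Fin 4) k ⧸ Ideal.span {f})))) → ¬ IsClosed ({x} : Set X₂) → (IsDomain (X₂.presheaf.stalk x) ∧ ∀ d : ℕ, ringKrullDim (X₂.presheaf.stalk x) = d → ∀ s : Fin d → X₂.presheaf.stalk x, (Ideal.span (Set.range s)).radical.IsMaximal → RingTheory.Sequence.IsWeaklyRegular (X₂.presheaf.stalk x) (List.ofFn s) ∧ ∀ t : X₂.presheaf.stalk x, (∃ e : ℕ, t ^ p ^ e ∈ Ideal.span ((fun z : X₂.presheaf.stalk x => z ^ p ^ e) '' (Ideal.span (Set.range s) : Set (X₂.presheaf.stalk x)))) → t ∈ Ideal.span (Set.range s)) := by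
  intro p _ k _ _ f hf η hη
  obtain ⟨h30, hlow⟩ := E8LineDeformedData.initialForm k f hf
  exact FilteredConeFiModelRel.filteredConeFiModelRel_strongPlusStep p k 4 ({1, 2, 3} : Finset (Fin 4)) ⟨1, by decide⟩
    (![0, 10, 6, 15] : Fin 4 → ℕ) 30 30 (![0, 3, 5, 2] : Fin 4 → ℕ) (by norm_num) weights_on_J weights_off_J
    (E8LineGradedFiModel.veroneseSplitting k) f (MvPolynomial.X 3 ^ 2 + MvPolynomial.X 1 ^ 3 + MvPolynomial.X 2 ^ 5) h30.symm hlow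
    (E8LineDeformedData.initialForm_ne_zero k) (E8LineDeformedData.isPrime_span_f k f hf).1 (E8LineDeformedData.X_ne_zero k f hf)
    (E8LineGradedFiModel.offStratum_clause_of_regular p k _ f (fun P _ hP => E8LineDeformedData.regular_off_line k f hf P hP))
    (E8LineGradedFiModel.offStratum_clause_of_regular p k _ _
      (fun P _ hP => E8LineGradedFiModel.regular_off_line k _ rfl P hP))
    η hη

end Summit.ResolutionOfSingularities.ResolutionOfSingularities.Theorems.FInjectiveMacaulayfication.E8LineDeformedFiModel

end
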